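import Summits.QuantumFields.BalabanUV.T4Continuum.Spine.NE5.TwoRunTorusNE5Usable

/-!
# Spine/NE5/TwoRunTorusNE5Uniform — the minimal END of row NE5 with the quantifiers in the PRODUCER's order: ONE
# constants record `c` first, then — for EVERY choice of the producer's O(1) letters, rates and BOND-CUBE SIDE `M` — the
# packages and the ∀-part (cell `pub-balaban-gaps`, seat `ne5` gen 14; located question (x15) closed on the NE5 side)

WHY.  T43 `TwoRunTorusNE5Usable.ne5_of_structural_data_usable_abs` (✓ p396426) reads: for given O(1) letters
`K̄_Γ, K̄_E, K̄_C, ε, κ, m, n_Λ, n_N, θ, s, R_σ0` there EXIST `c, M, w, α, γ₂, r_P, a₂₀, w₀` such that every family of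
structural data over the (2.14)-terms `terms L M Z` (bond cubes of side `M`, [II] p. 13) yields `T4OutputRate.NE5` BY NAME.
The bond-cube side `M` is EXPORTED by the ∃ — and the tree's Lemma-3 witness behind it
(`B13Lemma3TorusNonvacuity.numerics_nonvacuous_pos`, r10, ✓ p392209) fixes `M = 1`: its only `M`-dependent conjunct is the
(2.31) count `2·4·M⁴·e^{−a∕10} ≤ a∕20`.  A producer of Bałaban's ACTUAL records lives at `M` LARGE ([B9] Thm 3.7
p. 409 ∕ Thm 3.10 p. 415, verbatim *"For M sufficiently large"* — the random-walk expansions converge by *"the factor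
O(M^{−1∕2})"*, p. 410; [II] p. 13 `R_σ = ⅔M`; p. 21 R24 `κ + 1 ≤ δ₀M`), so the END in T43's exported form cannot be
invoked by it — located question (x15) of `HOME/ne/NE5.md` §19 (gen 13, zero ask on r10).  Moreover in T43's proof `c`
does not depend on the O(1) letters at all (T40 `scalars_of_rates` never reads `c`), a fact its ∃∀ shape hides.

THIS FILE.  §1 `lemma3_witness_allM`: ONE constants record `c` carries r10's 49 Lemma-3 ∕ (2.39)–(2.41) ∕ (2.18)
conjuncts (verbatim, same order) at EVERY bond-cube side `M ≥ 1`, with the rate re-run as `a + 80·log M` — derived from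
the landed witness by MONOTONICITY alone (every `a`-conjunct is «`a∕20` large», «`e^{−a∕20}` small» or monotone in the
(2.37) letter `A(a) = K₀·exp(64·e^{−a∕20})`, which decreases in `a`; the (2.31) count absorbs `M⁴` into `e^{−8 log M}`),
so no private lemma of r10's file is touched and `c` is literally r10's `consts`.  §2 `ne5_end_uniform`: THE END WITH
THE QUANTIFIERS IN THE PRODUCER'S ORDER — `∃ c` (with `8 ≤ c.L`, `1 ≤ c.κ₁`, the (2.18) clause) such that FOR ALL O(1)
letters, rates `θ, s`, `R_σ0` AND ALL `M ≥ 1` there exist `w, α, γ₂, r_P, a₂₀, w₀` with T43's window ∕ letter clauses and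
T43's ∀-part VERBATIM, concluding `NE5 … ((1−10δ)½Lκ) θ (2A₂C₃ε₁∕s)`.  So a producer reads `c` (hence `L := c.L`) FIRST,
then fixes its own `M ≥ M₀(L, …)` and its envelope letters, and only then receives the packages `w j` it must be
admissible for (T43's shape with `M` a parameter is the instance of §2 at that `M`).  Proof of §2 = T43's (T39
`ne5_of_records_symm_all_scales` fed by T40 and §1).  In print the (2.31) smallness is indeed required *"depending on
M"* (p. 18, the sentence after (2.31)).  Honest remark: a larger `M` raises the
rate `a` by `80 log M`, hence the exported small-field radius `r_P` (through `a ≤ γ₂ r_P²`) like `√(log M)` — the (2.22)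
demand on the producer's `χ`; in print `a = O(κ)` and `M = O(κ)` (R24), so `log M ≪ a` there.  The real letter `c.M` of
`B13.Consts` (R24, `ε₂`'s `M^q` with `q = 0`) and the bond-cube side `M` of `terms L M Z` are separate letters in the typed
chain, as in r10's witness; this file does not identify them.

HONEST FRAMING.  Quantifier bookkeeping over landed shapes (one ∃∀ re-ordered, one witness re-run by monotonicity);
nothing of Bałaban's is constructed or asserted beyond print.  NE5 NOT PRINTED ∕ NOT PROVED; leaves 0∕12; (D4) 0∕1; spine
0∕9.  Rung (B)+1 on a FIXED finite T⁴ — NOT continuum, NOT infinite volume, NOT mass gap, NOT Clay.  HONEST DEPENDENCY: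
continuum YM on T⁴ ⇐ BetaPertH ∧ nine spine estimates; BetaPertH ⇐ (D1) ∧ (D4) ∧ CAP+tail.  0 sorry, 0 `def`.

Sources: [II] = T. Bałaban, CMP **116** (1988) [Balaban1988RG2Cluster] p. 13, (2.13)–(2.26) pp. 14–17, (2.18) p. 16,
(2.31) p. 18, (2.37)–(2.38) p. 20, p. 21 («The assumptions allow finally us to fix all the constants»); [I] = CMP **109**
(1987) [Balaban1987RG1] (0.24)–(0.25) p. 257; [B9] = CMP **99** (1985) [Balaban1985BackgroundPropagators] Thm 3.7 p. 409,
p. 410, Thm 3.10 pp. 415–416.  Nothing here is a claim about the Yang–Mills mass gap.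
-/

noncomputable section

namespace Summit.QuantumFields.BalabanUV.T4Continuum.Spine.NE5.TwoRunTorusNE5Uniform

open Matrix Metric Set Finset
open Literature.MathematicalPhysics.QuantumFieldTheory.Balaban1983to89
open Literature.MathematicalPhysics.QuantumFieldTheory.Balaban1983to89.T4OutputRate (NE5)
open Literature.MathematicalPhysics.QuantumFieldTheory.Balaban1983to89.TreeLengthTorus (TPt TDom tsys)
open Literature.MathematicalPhysics.QuantumFieldTheory.Balaban1983to89.TreeLengthTorusGeometry (TTouch)
open Literature.MathematicalPhysics.QuantumFieldTheory.Balaban1983to89.TreeLengthTorusTransfer (tclosure)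
open Literature.MathematicalPhysics.QuantumFieldTheory.Balaban1983to89.B13Lemma3TorusData (TBond)
open Literature.MathematicalPhysics.QuantumFieldTheory.Balaban1983to89.B13Lemma3Torus (TwoTorusStep)
open Literature.MathematicalPhysics.QuantumFieldTheory.Balaban1983to89.B13Lemma3TorusTerms (terms weight Z0)
open Literature.MathematicalPhysics.QuantumFieldTheory.Balaban1983to89.B13Term214 (core214 F214 term214)
open Literature.MathematicalPhysics.QuantumFieldTheory.Balaban1983to89.B13Bound143 (invTau)
open Literature.MathematicalPhysics.QuantumFieldTheory.Balaban1983to89.B5TorusCover (UT)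
open Literature.MathematicalPhysics.QuantumFieldTheory.Balaban1983to89.B12TreeDecay (kappa₀ K₀ K₀_pos)
open Literature.MathematicalPhysics.QuantumFieldTheory.Balaban1983to89.B13Resummation (locE)
open Literature.MathematicalPhysics.QuantumFieldTheory.Balaban1983to89.B13TermWalkData
  (WalkConsts TermKernels TermWalkData)
open Summit.QuantumFields.BalabanUV.T4Continuum.Spine.NE5.TwoRunTorusNE5Records (ne5_of_records_symm_all_scales)
open Summit.QuantumFields.BalabanUV.T4Continuum.Spine.NE5.TwoRunTorusNE5Scalars (scalars_of_rates)
open Summit.QuantumFields.BalabanUV.T4Continuum.Spine.NE5.TwoRunTorusNE5 (torusCarriers reFunctional)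
open Literature.MathematicalPhysics.QuantumFieldTheory.Balaban1983to89.B13Lemma3TorusNonvacuity (numerics_nonvacuous_pos)

/-! ## §1. The Lemma-3 witness at EVERY bond-cube side `M` — one constants record for all `M` -/

/-- The (2.37) letter `A(a) = K₀·exp(e^{−a∕20}·64)` is antitone in the rate `a`. [folklore] -/
theorem A237_antitone {a a' : ℝ} (h : a ≤ a') :
    K₀ 64 8 * Real.exp (Real.exp (-(a' / 20)) * 64) ≤ K₀ 64 8 * Real.exp (Real.exp (-(a / 20)) * 64) := by
  apply mul_le_mul_of_nonneg_left _ (K₀_pos 64 8).le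
  rw [Real.exp_le_exp]
  apply mul_le_mul_of_nonneg_right _ (by norm_num)
  rw [Real.exp_le_exp]
  linarith

/-- `e^{−8·log M} = (M⁸)⁻¹` for a positive natural `M`: the factor by which the re-run rate `a + 80 log M` improves
`e^{−a∕10}`. [folklore] -/
theorem exp_neg_eight_log {M : ℕ} (hM : 0 < M) : Real.exp (-(8 * Real.log (M : ℝ))) = ((M : ℝ) ^ 8)⁻¹ := by
  have hM' : (0 : ℝ) < (M : ℝ) := Nat.cast_pos.2 hM
  rw [Real.exp_neg, show (8 : ℝ) * Real.log (M : ℝ) = Real.log ((M : ℝ) ^ 8) by rw [Real.log_pow]; norm_num,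
    Real.exp_log (pow_pos hM' 8)]

/-- **THE LEMMA-3 WITNESS AT EVERY BOND-CUBE SIDE.**  ONE constants record `c` (r10's `B13Lemma3TorusNonvacuity.consts`,
read through `numerics_nonvacuous_pos`) and ONE choice of the auxiliary letters `a₂, a₂', a₅, Aabs, Bc` satisfy, for
EVERY `M ≥ 1` and a rate `a` depending on `M`, the 49 conjuncts of `numerics_nonvacuous_pos`
VERBATIM (restrictions R15–R18, R20, R22–R24, the smallness of (2.29) ∕ (2.31), the O(1) of (2.37) ∕ (2.38) ∕ (2.41), the
½E₀ bookkeeping, `a₅ > 0`, `κ₁ ≥ 1`, the (2.18) clause `0 < 1∕|τ(Y)| ≤ ½`) with the rate re-run as `a + 80·log M`: every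
`a`-conjunct is monotone («`a∕20` large», «`e^{−a∕20}` small», or antitone through the (2.37) letter `A(a)`, `A237_antitone`),
and the (2.31) count p. 18 — the only conjunct where the bond-cube side enters (p. 18: *"one bond in P may connect two
cubes"*, the smallness after (2.31) being required *"depending on M"*) — absorbs `M⁴` into `e^{−8 log M} = M⁻⁸`.
(Consistency of the typed list at every `M`, not the size of Bałaban's constants; in print `a = O(κ)`, `M = O(κ)` by R24.)
[cite: Balaban1988RG2Cluster, (2.31) p.18, (2.37) p.20, p.21 (closing paragraph: "The assumptions allow finally us to fix all the constants"), (2.18) p.16] -/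
theorem lemma3_witness_allM :
    ∃ (c : B13.Consts) (a₂ a₂' a₅ Aabs Bc : ℝ), ∀ M : ℕ, 0 < M → ∃ a : ℝ,
      8 ≤ c.L ∧ 0 < M ∧ 0 < c.ε₁ ∧ 0 < c.α₆ ∧ 0 ≤ c.eps2 ∧ 0 ≤ c.δ ∧ 0 ≤ 1 - 7 * c.δ ∧ 0 ≤ c.κ ∧ 0 ≤ a ∧
      c.R15 ∧ 18 * ((1 - 4 * c.δ) * c.κ) ≤ a / 20 ∧ 4 * c.κ ≤ a / 20 ∧ Real.exp (-(a / 20)) ≤ c.eps2 ∧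
      2 * (4 : ℝ) * (M : ℝ) ^ 4 * Real.exp (-(a / 10)) ≤ a / 20 ∧
      0 ≤ a₂ ∧ kappa₀ 64 8 + a₂ ≤ c.δ * c.κ ∧ c.α₆ * Real.exp a₂ * K₀ 64 8 * 64 ≤ a₂ ∧
      Real.exp (-(a / 20)) * 64 ≤ c.δ * c.κ ∧
      B13Step237.R18half c (K₀ 64 8 * Real.exp (Real.exp (-(a / 20)) * 64)) ∧
      B13Step237.R18sharp c (K₀ 64 8 * Real.exp (Real.exp (-(a / 20)) * 64)) ((c.L : ℝ) / 2) ∧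
      0 ≤ a₂' ∧ kappa₀ 64 8 + a₂' ≤ c.δ * ((c.L : ℝ) / 2) * c.κ ∧ c.α₆ * Real.exp a₂' * K₀ 64 8 * 64 ≤ a₂' ∧
      18 * ((1 - 7 * c.δ) * ((c.L : ℝ) / 2) * c.κ) ≤ (c.κ₁ - 1) / 2 ∧
      0 ≤ a₅ ∧ a₅ + Real.exp (-((c.κ₁ - 1) / 2)) ≤ Aabs ∧ Aabs * 64 ≤ c.δ * ((c.L : ℝ) / 2) * c.κ ∧
      B13Step237.bracketF c (K₀ 64 8 * Real.exp (Real.exp (-(a / 20)) * 64)) / c.α₆ * Real.exp (Aabs * 64) ≤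
        c.C3act * c.ε₁ ∧
      0 ≤ c.C3act * c.ε₁ ∧ c.κ + 2 * (64 * Real.log 162) + 2 ≤ (1 - 8 * c.δ) * ((c.L : ℝ) / 2) * c.κ ∧
      c.C3act * c.ε₁ * Real.exp (5 * c.κ + 1) * K₀ 64 8 * 9 * 64 ≤ 1 ∧
      Real.exp 1 * 9 * 64 * K₀ 64 8 ^ 2 ≤ c.A₂ ∧ c.R22 ∧ c.R23 ∧ c.R24sharp ∧ 0 ≤ c.E₀ ∧
      0 ≤ Bc ∧ Bc * 64 ≤ c.E₀ / 2 ∧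
      0 < a₅ ∧ 1 ≤ c.κ₁ ∧
      (∀ d : ℝ, 0 ≤ d → 0 < invTau c d ∧ invTau c d ≤ 1 / 2) := by
  obtain ⟨c, M₁, a, a₂, a₂', a₅, Aabs, Bc, hL, hM₁, hε₁, hα₆, hε₀, hδ, hδ7, hκc, ha, hR15, hR16, hR16', hR17, h231,
    ha₂, hκ229, hsm229, habsk, h18half, h18, ha₂', hκ229', hsm229', hR20, ha₅0, habs, hAc, hC3, hAct, hlarge,
    hsmall41, hA₂, hR22, hR23, hR24, hE₀, hBc, hBcE, ha₅, hκ₁, hτ⟩ :=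
    numerics_nonvacuous_pos
  refine ⟨c, a₂, a₂', a₅, Aabs, Bc, fun M hM => ?_⟩
  -- the re-run rate
  have hMr : (1 : ℝ) ≤ (M : ℝ) := by exact_mod_cast hM
  have hlog : 0 ≤ Real.log (M : ℝ) := Real.log_nonneg hMr
  have haa : a ≤ a + 80 * Real.log (M : ℝ) := by linarith
  have ha' : 0 ≤ a + 80 * Real.log (M : ℝ) := by linarith
  have h20 : a / 20 ≤ (a + 80 * Real.log (M : ℝ)) / 20 := by linarith
  have hexp : Real.exp (-((a + 80 * Real.log (M : ℝ)) / 20)) ≤ Real.exp (-(a / 20)) := by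
    rw [Real.exp_le_exp]; linarith
  -- the (2.37) letter at the two rates
  have hA := A237_antitone haa
  have hA0 : 0 ≤ K₀ 64 8 * Real.exp (Real.exp (-((a + 80 * Real.log (M : ℝ)) / 20)) * 64) :=
    mul_nonneg (K₀_pos 64 8).le (Real.exp_pos _).le
  have hL2 : 0 ≤ ((c.L : ℝ) + 2) ^ 4 := by positivity
  have hmem : B13Step237.memberF c (K₀ 64 8 * Real.exp (Real.exp (-((a + 80 * Real.log (M : ℝ)) / 20)) * 64)) ≤
      B13Step237.memberF c (K₀ 64 8 * Real.exp (Real.exp (-(a / 20)) * 64)) := by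
    unfold B13Step237.memberF
    exact mul_le_mul_of_nonneg_right (mul_le_mul_of_nonneg_left hA hL2) hε₀
  have hbr : B13Step237.bracketF c (K₀ 64 8 * Real.exp (Real.exp (-((a + 80 * Real.log (M : ℝ)) / 20)) * 64)) ≤
      B13Step237.bracketF c (K₀ 64 8 * Real.exp (Real.exp (-(a / 20)) * 64)) := by
    unfold B13Step237.bracketF
    linarith
  refine ⟨a + 80 * Real.log (M : ℝ), hL, hM, hε₁, hα₆, hε₀, hδ, hδ7, hκc, ha', hR15,
    hR16.trans h20, hR16'.trans h20, hexp.trans hR17, ?_, ha₂, hκ229, hsm229, ?_, ?_, ?_, ha₂', hκ229', hsm229', hR20,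
    ha₅0, habs, hAc, ?_, hAct, hlarge, hsmall41, hA₂, hR22, hR23, hR24, hE₀, hBc, hBcE, ha₅, hκ₁, hτ⟩
  · -- the (2.31) count: `8 M⁴ e^{−(a + 80 log M)∕10} = 8 e^{−a∕10} M⁻⁴ ≤ 8 M₁⁴ e^{−a∕10} ≤ a∕20`
    have hM' : (0 : ℝ) < (M : ℝ) := Nat.cast_pos.2 hM
    have hM₁r : (1 : ℝ) ≤ (M₁ : ℝ) := by exact_mod_cast hM₁
    have hsplit : Real.exp (-((a + 80 * Real.log (M : ℝ)) / 10)) =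
        Real.exp (-(a / 10)) * ((M : ℝ) ^ 8)⁻¹ := by
      rw [← exp_neg_eight_log hM, ← Real.exp_add]
      congr 1
      ring
    rw [hsplit]
    have hE : 0 ≤ Real.exp (-(a / 10)) := (Real.exp_pos _).le
    have hM4 : (1 : ℝ) ≤ (M : ℝ) ^ 4 := one_le_pow₀ hMr
    have hM8 : (M : ℝ) ^ 4 * ((M : ℝ) ^ 8)⁻¹ ≤ 1 := by
      rw [show (M : ℝ) ^ 8 = (M : ℝ) ^ 4 * (M : ℝ) ^ 4 by ring, mul_inv, ← mul_assoc,
        mul_inv_cancel₀ (pow_pos hM' 4).ne', one_mul]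
      exact inv_le_one_of_one_le₀ hM4
    have hM₁4 : (1 : ℝ) ≤ (M₁ : ℝ) ^ 4 := one_le_pow₀ hM₁r
    calc 2 * (4 : ℝ) * (M : ℝ) ^ 4 * (Real.exp (-(a / 10)) * ((M : ℝ) ^ 8)⁻¹)
        = 2 * 4 * Real.exp (-(a / 10)) * ((M : ℝ) ^ 4 * ((M : ℝ) ^ 8)⁻¹) := by ring
      _ ≤ 2 * 4 * Real.exp (-(a / 10)) * 1 := mul_le_mul_of_nonneg_left hM8 (by positivity)
      _ ≤ 2 * 4 * Real.exp (-(a / 10)) * (M₁ : ℝ) ^ 4 := mul_le_mul_of_nonneg_left hM₁4 (by positivity)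
      _ = 2 * 4 * (M₁ : ℝ) ^ 4 * Real.exp (-(a / 10)) := by ring
      _ ≤ a / 20 := h231
      _ ≤ (a + 80 * Real.log (M : ℝ)) / 20 := h20
  · -- the absorption `64 e^{−a∕20} ≤ δκ`
    exact (mul_le_mul_of_nonneg_right hexp (by norm_num)).trans habsk
  · -- R18 ((L+2)⁴O(1)ε₂ ≤ ½): monotone in the (2.37) letter
    unfold B13Step237.R18half at h18half ⊢
    exact hmem.trans h18half
  · -- R18 sharp form: monotone in the (2.37) letter
    unfold B13Step237.R18sharp at h18 ⊢
    exact (mul_le_mul_of_nonneg_right hbr (Real.exp_pos _).le).trans h18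
  · -- the O(1) of C₃: monotone in the (2.37) letter (`α₆ > 0`)
    exact (mul_le_mul_of_nonneg_right (div_le_div_of_nonneg_right hbr hα₆.le) (Real.exp_pos _).le).trans hC3

open Classical in
/-- **THE END WITH THE QUANTIFIERS IN THE PRODUCER'S ORDER.**  There is ONE constants record `c` with `8 ≤ c.L`,
`1 ≤ c.κ₁` and the (2.18) clause `∀ d ≥ 0, 0 < invTau c d ≤ ½` such that FOR ALL fibre data `ν, Nf`, O(1) letters
`K̄_Γ, K̄_E, K̄_C ≥ 0`, `ε, κ > 0`, `m`, `n_Λ, n_N ≥ 0`, rates `θ, s > 0`, `R_σ0` AND EVERY BOND-CUBE SIDE `M ≥ 1` there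
exist packages `w j` (letters = the given ones; `Admissible (α j) R_σ0`, `1 < α j`, `s∕θ^j ≤ α j` on the window) and
`γ₂ > 0, r_P, a₂₀ ≥ 0, w₀ > 0` for which T43's ∀-part holds VERBATIM: every family of torus models, τ-regions, contour radius
`0 < r ≤ e^{κ₁} − 1`, parameter lists, walk records at `c⁺` over `terms L M Z` with `TermWalkData`, σ-holomorphy,
symmetry, potentials with (2.20), `χ` with (2.22), fibre ∕ size bounds, activities by (2.14)-summation and outputs by
(2.13) yields `NE5 (torus carriers) … ((1−10δ)½Lκ) θ (2A₂C₃ε₁∕s)` BY NAME.  So the producer reads `c` (and `L := c.L`)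
first, then fixes ITS `M` and envelope letters (NODE O at `M ≥ M₀`: [B9] Thm 3.7 p. 409 *"For M sufficiently large"*)
— located question (x15) closed on the NE5 side.  Proof: T39 fed by T40 and `lemma3_witness_allM`, as in T43.
[cite: Balaban1987RG1, (0.24)–(0.25) p.257; Balaban1988RG2Cluster, p.13, (2.13)–(2.26) pp.14–17, (2.18) p.16, (2.31) p.18, (2.38) p.20, p.21; Balaban1985BackgroundPropagators, Thm 3.7 p.409, Thm 3.10 p.416] -/
theorem ne5_end_uniform :
    ∃ c : B13.Consts, 8 ≤ c.L ∧ 1 ≤ c.κ₁ ∧ (∀ d : ℝ, 0 ≤ d → 0 < invTau c d ∧ invTau c d ≤ 1 / 2) ∧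
      ∀ {ν : ℕ} {Nf : ℕ → Fin ν → ℕ} [∀ j i, NeZero (Nf j i)],
      ∀ {KΓ KE KC ε κ : ℝ}, 0 ≤ KΓ → 0 ≤ KE → 0 ≤ KC → 0 < ε → 0 < κ → ∀ (m : ℕ) {nΛ nN : ℝ}, 0 ≤ nΛ → 0 ≤ nN →
      ∀ {θ s : ℝ}, 0 < θ → 0 < s → ∀ (Rσ₀ : ℝ) (M : ℕ) [NeZero M],
      ∃ (w : ℕ → WalkConsts) (α : ℕ → ℝ) (γ₂ rP a₂₀ w₀ : ℝ),
      (∀ j, (w j).Admissible (α j) Rσ₀) ∧ (∀ j, 1 < α j) ∧ (∀ j, θ ^ j < s → s / θ ^ j ≤ α j) ∧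
      (∀ j, (w j).KbarΓ = KΓ ∧ (w j).KbarE = KE ∧ (w j).KbarC = KC ∧ (w j).kap = κ ∧ (w j).ε = ε) ∧
      0 < γ₂ ∧ 0 ≤ a₂₀ ∧ 0 < w₀ ∧
      ∀ {L : ℕ} [NeZero L], c.L = L → ∀ (N : ℕ → ℕ) [∀ j, NeZero (N j)] (W : (j : ℕ) → TwoTorusStep 4 L (N j))
        {Uτ : (j : ℕ) → TDom 4 (L * N j) → Set ℂ}, (∀ j Y, IsOpen (Uτ j Y)) →
        (∀ j, ∀ Y : TDom 4 (L * N j), closedBall (0 : ℂ) ((invTau c ((tsys 4 (L * N j)).dj Y))⁻¹) ⊆ Uτ j Y) →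
        ∀ {r : ℝ}, 0 < r → r ≤ Real.exp c.κ₁ - 1 → (∀ j Y, ∀ ζ ∈ Set.uIcc (0 : ℝ) 1, closedBall (ζ : ℂ) r ⊆ Uτ j Y) →
        ∀ (lZ : (j : ℕ) → TDom 4 (N j) → Finset (TDom 4 (L * N j)) × Finset (TBond 4 M (L * N j)) → List (TPt 4 (N j))),
        (∀ j Z t, (lZ j Z t).Nodup ∧ (lZ j Z t).toFinset = Z.1 \ tclosure L (N j) (Z0 M t)) →
        ∀ (lD : (j : ℕ) → Finset (TDom 4 (L * N j)) × Finset (TBond 4 M (L * N j)) → List (TDom 4 (L * N j))),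
        (∀ j t, (lD j t).Nodup ∧ (lD j t).toFinset = t.1) →
        ∀ (𝒦 : (j : ℕ) → (Z : TDom 4 (N j)) → Finset (TDom 4 (L * N j)) × Finset (TBond 4 M (L * N j)) → (W j).Φ →
            TermKernels ({ c with κ₁ := c.κ₁ + 1 } : B13.Consts) 4 (N j) ν (Nf j) ℂ)
          [∀ j Z t φ, Fintype (𝒦 j Z t φ).C₀] [∀ j Z t φ, DecidableEq (𝒦 j Z t φ).C₀],
        (∀ j Z, ∀ t ∈ terms L M Z, ∀ φ, φ ∈ (W j).sp2 Z → TermWalkData (𝒦 j Z t φ) (w j)) →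
        ∀ (Γ : (j : ℕ) → (Z : TDom 4 (N j)) → (t : Finset (TDom 4 (L * N j)) × Finset (TBond 4 M (L * N j))) →
            (φ : (W j).Φ) → ℂ → (TPt 4 (N j) → ℂ) → ((𝒦 j Z t φ).Λ ⊕ (𝒦 j Z t φ).C₀ → ℝ) → ((𝒦 j Z t φ).Λ → ℂ)),
        (∀ j Z, ∀ t ∈ terms L M Z, ∀ φ, φ ∈ (W j).sp2 Z → ∀ b ∈ ball (0 : ℂ) (α j), ∀ σ : TPt 4 (N j) → ℂ,
          (∀ i, σ i ∈ ball (0 : ℂ) (Real.exp (c.κ₁ + 1))) →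
            ∀ X : (𝒦 j Z t φ).Λ ⊕ (𝒦 j Z t φ).C₀ → ℝ, Γ j Z t φ b σ X = (𝒦 j Z t φ).G2 σ b *ᵥ fun i => (X i : ℂ)) →
        ∀ (χY₀ χcP : (j : ℕ) → (Z : TDom 4 (N j)) → (t : Finset (TDom 4 (L * N j)) × Finset (TBond 4 M (L * N j))) →
            (φ : (W j).Φ) → ((𝒦 j Z t φ).Λ → ℝ) → ℝ),
        (∀ j Z t φ Bf, 0 ≤ χY₀ j Z t φ Bf) → (∀ j Z t φ Bf, 0 ≤ χcP j Z t φ Bf) →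
        ∀ (Dfam : (j : ℕ) → TDom 4 (N j) → Finset (TDom 4 (L * N j)) × Finset (TBond 4 M (L * N j)) →
            Finset (TDom 4 (L * N j)))
          (Vk : (j : ℕ) → (Z : TDom 4 (N j)) → (t : Finset (TDom 4 (L * N j)) × Finset (TBond 4 M (L * N j))) →
            (φ : (W j).Φ) → ℂ → TDom 4 (L * N j) → ((𝒦 j Z t φ).Λ → ℝ) → ℂ),
        (∀ j Z, ∀ t ∈ terms L M Z, ∀ φ, φ ∈ (W j).sp2 Z → ∀ b ∈ ball (0 : ℂ) (α j), ∀ i i',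
          DifferentiableOn ℂ (fun σ => (𝒦 j Z t φ).A2 σ b i i') {σ | ∀ i, σ i ∈ ball (0 : ℂ) (Real.exp (c.κ₁ + 1))}) →
        (∀ j Z, ∀ t ∈ terms L M Z, ∀ φ, φ ∈ (W j).sp2 Z → ∀ b ∈ ball (0 : ℂ) (α j), ∀ i i',
          DifferentiableOn ℂ (fun σ => (𝒦 j Z t φ).G2 σ b i i') {σ | ∀ i, σ i ∈ ball (0 : ℂ) (Real.exp (c.κ₁ + 1))}) →
        (∀ j Z, ∀ t ∈ terms L M Z, ∀ φ, φ ∈ (W j).sp2 Z → ∀ Y Bf,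
          DifferentiableOn ℂ (fun b => Vk j Z t φ b Y Bf) (ball (0 : ℂ) (α j))) →
        (∀ j Z t φ, Measurable (χY₀ j Z t φ)) → (∀ j Z t φ, Measurable (χcP j Z t φ)) →
        (∀ j Z, ∀ t ∈ terms L M Z, ∀ φ, φ ∈ (W j).sp2 Z → ∀ b ∈ ball (0 : ℂ) (α j), ∀ Y,
          Measurable (Vk j Z t φ b Y)) →
        (∀ j Z, ∀ t ∈ terms L M Z, ∀ φ, φ ∈ (W j).sp2 Z → ∀ b : ℂ, ‖b‖ ≤ α j → ∀ σ : TPt 4 (N j) → ℂ,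
          (∀ i, ‖σ i‖ ≤ Real.exp (c.κ₁ + 1)) → ((𝒦 j Z t φ).A2 σ b).IsSymm) →
        ∀ {w₂₀ : ℝ} (qP : (j : ℕ) → (Z : TDom 4 (N j)) → (t : Finset (TDom 4 (L * N j)) × Finset (TBond 4 M (L * N j))) →
            (φ : (W j).Φ) → ((𝒦 j Z t φ).Λ → ℝ) → ℝ),
        (∀ j Z t φ Bf, χY₀ j Z t φ Bf * χcP j Z t φ Bf ≤
          Real.exp (-(γ₂ / 2 * rP ^ 2 * (t.2.card : ℕ)) + γ₂ / 2 * qP j Z t φ Bf)) →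
        (∀ j Z t φ Bf, qP j Z t φ Bf ≤ Bf ⬝ᵥ Bf) →
        (∀ j Z, ∀ t ∈ terms L M Z, ∀ φ, φ ∈ (W j).sp2 Z → ∀ b ∈ ball (0 : ℂ) (α j),
          ∀ τ : TDom 4 (L * N j) → ℂ, (∀ Y, τ Y ∈ Uτ j Y) →
            ∀ Bf, ∑ Y ∈ Dfam j Z t, ‖τ Y‖ * ‖Vk j Z t φ b Y Bf‖ ≤ a₂₀ / 2 * (Bf ⬝ᵥ Bf) + w₂₀) →
        (∀ j, ∀ Z : TDom 4 (N j), w₂₀ ≤ w₀ * ((Z.1).card : ℝ)) →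
        (∀ j Z t φ, (𝒦 j Z t φ).m ≤ m) →
        (∀ j Z t φ, ∀ x : UT (Nf j), (Finset.univ.filter fun i => (𝒦 j Z t φ).locN i = x).card ≤ m) →
        (∀ j Z t φ, (Fintype.card (𝒦 j Z t φ).Λ : ℝ) ≤ nΛ * ((Z.1).card : ℝ)) →
        (∀ j Z t φ, (Fintype.card ((𝒦 j Z t φ).Λ ⊕ (𝒦 j Z t φ).C₀) : ℝ) ≤ nN * ((Z.1).card : ℝ)) →
        ∀ {H : (j : ℕ) → ℂ → TDom 4 (N j) → (W j).Φ → ℂ},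
        (∀ j, ∀ b ∈ ball (0 : ℂ) (α j), ∀ (Z : TDom 4 (N j)) (φ : (W j).Φ), φ ∈ (W j).sp2 Z →
          H j b Z φ = ∑ t ∈ terms L M Z,
            term214 r (lZ j Z t) (lD j t) (core214 (fun σ => (𝒦 j Z t φ).A2 σ b) (Γ j Z t φ b)
              (F214 t.2.card (χY₀ j Z t φ) (χcP j Z t φ) (Dfam j Z t) (Vk j Z t φ b))) 0 0) →
        (∀ j, ∀ X Z : TDom 4 (N j), ∀ φ, Z.1 ⊆ X.1 → φ ∈ (W j).sp2 X → φ ∈ (W j).sp2 Z) →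
        ∀ {E : (j : ℕ) → ℂ → TDom 4 (N j) → (W j).Φ → ℂ},
        (∀ j, ∀ b ∈ ball (0 : ℂ) (α j), ∀ (X : TDom 4 (N j)) (φ : (W j).Φ), φ ∈ (W j).sp2 X →
          E j b X φ = locE (TTouch (d := 4) (N := N j)) (fun Z : TDom 4 (N j) => Z.1) (fun Z => H j b Z φ) X.1) →
        ∀ W' : Set (ℕ → ℝ),
        NE5 (C := torusCarriers N W) (reFunctional N W fun j => E j 0) (reFunctional N W fun j => E j 1) W'
          ((1 - 10 * c.δ) * ((c.L : ℝ) / 2) * c.κ) θ (2 * (c.A₂ * c.C3act * c.ε₁) / s) := by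
  obtain ⟨c, a₂, a₂', a₅, Aabs, Bc, hc⟩ := lemma3_witness_allM
  -- the clauses on `c` alone, read at `M = 1`
  obtain ⟨-, hL, -, -, -, -, -, -, -, -, -, -, -, -, -, -, -, -, -, -, -, -, -, -, -, -, -, -,
    -, -, -, -, -, -, -, -, -, -, -, -, hκ₁, hτ⟩ := hc 1 Nat.one_pos
  refine ⟨c, hL, hκ₁, hτ, ?_⟩
  intro ν Nf _ KΓ KE KC ε κ hKΓ hKE hKC hε hκ m nΛ nN hnΛ hnN θ s hθ hs Rσ₀ M _
  obtain ⟨a, -, -, -, hα₆, hε₀, hδ, hδ7, hκc, ha, hR15, hR16, hR16', hR17, h231,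
    ha₂, hκ229, hsm229, habsk, h18half, h18, ha₂', hκ229', hsm229', hR20, ha₅0, habs, hAc, hC3, hAct, hlarge,
    hsmall41, hA₂, hR22, -, -, -, -, -, ha₅, -, -⟩ := hc M (Nat.pos_of_ne_zero (NeZero.ne M))
  -- T40: every non-Lemma-3 scalar letter, rate chain 4κ∕5 > 3κ∕5 > 2κ∕5 > κ∕5
  have hκa : 4 * κ / 5 < κ := by linarith
  have hκb : 3 * κ / 5 < 4 * κ / 5 := by linarith
  have h2 : 2 * κ / 5 < 3 * κ / 5 := by linarith
  have h1 : κ / 5 < 2 * κ / 5 := by linarith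
  have h0 : 0 < κ / 5 := by linarith
  obtain ⟨w, α, ϑ, cE, g, γ₂, a₂₀, w₀, rP, hw, hα1, hαs, hsm, hκaw, hlett, -, -, -, hR1, hKθ, hcEj, hgEj, hRe,
    hγ₂, ha₂₀, hαc, hsmallG, hPa, hw₀, hvol⟩ :=
    scalars_of_rates θ s Rσ₀ hKΓ hKE hKC hε hκ (Nat.cast_nonneg m) ν hκa hκb h2 h1 h0 hnΛ hnN ha ha₅
  refine ⟨w, α, γ₂, rP, a₂₀, w₀, hw, hα1, hαs, hlett, hγ₂, ha₂₀, hw₀, ?_⟩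
  intro L _ hLc N _ W Uτ hUτ hUtau r hr hr' hsubτ lZ hlZ lD hlD 𝒦 _ _ h𝒦 Γ hlin χY₀ χcP hχ0 hχc0 Dfam Vk hAhol
    hGhol hVholb hχm hχcm hVm hAs w₂₀ qP h222 hqP h220U hw₂₀ hm hfibN hΛ hN H hH hsp E h213 W'
  -- R22: `(1 − 10δ)·½L = 1`, so the closing numerics read at `κ`
  have h22 : (1 - 10 * c.δ) * ((c.L : ℝ) / 2) = 1 := hR22
  have hmul : (1 - 10 * c.δ) * ((c.L : ℝ) / 2) * c.κ = c.κ := by rw [h22, one_mul]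
  exact ne5_of_records_symm_all_scales c hL hLc hκ₁ hα₆.ne' N W hθ hs
    (fun j Y => (hτ _ ((tsys 4 (L * N j)).dj_nonneg Y)).1) (fun j Y => (hτ _ ((tsys 4 (L * N j)).dj_nonneg Y)).2)
    hUτ hUtau hr hr' hsubτ lZ hlZ lD hlD 𝒦 hw hα1 hαs h𝒦 Γ hlin χY₀ χcP hχ0 hχc0 Dfam Vk hAhol hGhol hVholb hχm
    hχcm hVm hAs qP h222 hγ₂.le hqP ha₂₀ h220U hm hfibN hκaw hκb h2 h1 h0 hsm
    (fun j Z t φ => hR1 j _ (Nat.cast_nonneg _) (Nat.cast_le.2 (hm j Z t φ))) hKθ hcEj hgEj hRe hαc hsmallG hPa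
    (fun j Z t _ φ _ => hvol j _ _ _ _ (Nat.cast_nonneg _) (Nat.cast_nonneg _) (Nat.cast_nonneg _) (hΛ j Z t φ)
      (hN j Z t φ) (hw₂₀ j Z))
    hα₆ hε₀ hδ hδ7 hκc ha hR15 hR16 hR16' hR17 h231 ha₂ hκ229 hsm229 habsk h18half h18 ha₂' hκ229' hsm229' hR20
    ha₅0 habs hAc hC3 hH hsp h213 hAct (by rw [hmul]; exact hκc) (by rw [hmul]; exact hlarge)
    (by rw [hmul]; exact hsmall41) hA₂ W'

end Summit.QuantumFields.BalabanUV.T4Continuum.Spine.NE5.TwoRunTorusNE5Uniform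

end
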